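import Summits.QuantumFields.BalabanUV.T4Continuum.Support.ShellMeasureWilsonLedger

/-!
# `T4Continuum.ShellMeasureWilsonLedgerSource` — row S19 file 2: the level-0 ledger of the `SU(2)` Gibbs measure WITH A
# BOUNDED SOURCE INSERTION `e^{t·F(U)}`, `|t| ≤ l₀` — the generating-function measures of the two-run comparison —
# (M1)₀ transferred through any two-sided bounded density factor at the price `e^{2 l₀ w}` in the constant
# (cell `pub-balaban`, sub-cell `t4`, spine estimate NE7c (node U5b); NE7c ROUND-2 crew `t4-ne7c-formalise-*`, unit
# `b2b-balaban-t4-ne7c-formalise-leaf-06`, row S19 (owner RECUT, journal l.6666) file 2; ADDITIVE — imports row S19's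
# `ShellMeasureWilsonLedger` (p209189) only; 0 `def`, 0 sorry, 0 cite tags)

HONEST FRAMING.  Finite four-torus programme, rung (B)+1 only — NOT infinite volume, NOT a mass gap, NOT the Clay
problem, NOT summit progress.  NE7c = `T4IndicatorShell.ShellWeightBound` is NOT PRINTED in [Balaban 1983–89] and NOT
PROVED; «NE7c ⇐ the named binders» (trigger c3); a ONE-run level-0 ledger is NOT NE7c.  File 1 left the source
strength `t` idle («one lattice, constant in K and t … a bounded source insertion is the same proof pointwise, not
written»); this file writes it: the generating functions `Z_K(t) = ∫ e^{t·F} e^{−β S_W} dU` of `T4WeightBudget` /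
`T4IndicatorShell.cauchy_of_relWeightBound_shell` are positive integrals against the TILTED Gibbs law
`e^{t·F(U)} e^{−β Σ_p (1 − reTr U(∂p))} dU`, `F` a bounded measurable observable (a Wilson loop, `|F| ≤ w`), and (M1)₀
passes from the untilted law (file 1 §1, rows S1/S2 BY NAME) to the tilted one through the elementary two-sided bound
`e^{−l₀w} ≤ e^{tF} ≤ e^{l₀w}`, constant `× e^{2 l₀ w}` — uniform in `K` and in `|t| ≤ l₀`.  Nothing printed is asserted;
[folklore] throughout.  HONEST DEPENDENCY (cell): continuum YM on T⁴ ⇐ BetaPertH ∧ nine spine estimates (0/9 proved);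
BetaPertH ⇐ (D1) ∧ (D4) ∧ CAP+tail; G-an2-4 gates asym, D1 and NE2/3/4.

## What is proved (all [folklore])

* §1 (any measure space) `slotAntiConcentration_smul` ((M1) is invariant under scaling the measure);
  `slotAntiConcentration_withDensity_mul_of_bounds` — (M1) for `F dν` with constant `D` and a measurable factor
  `a ≤ g ≤ b` (`0 < a`, `b < ∞`) ⟹ (M1) for `(g·F) dν` with constant `D·(b/a)` (`T4ShellMeasureFibre.slotAntiConcentration_of_dominated`);
  `slotAntiConcentration_withDensity_mul_exp` — the factor `e^{t·f}` with `|f| ≤ w`, `|t| ≤ l₀`: constant `D·e^{2 l₀ w}`.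
* §2 `slotAntiConcentration_wilson_su2_gibbs_source` — file 1's `…_gibbs_of_union` tilted by `e^{t·F(U)}`:
  (M1)₀ for `(fieldMeasure P j SU2).withDensity (e^{t F(U)} · e^{−β Σ_{P_all}(1 − reTr U(∂p))})` and `wilsonU P_u`,
  constant `2(n + β·#P_w·8S(8+32S))/(1−δ) · e^{2 l₀ w}`.
* §3 `levelLedger_wilson_su2_levelZero_source` — file 1's §2 with the realized measure of every slot THE TILTED law
  `μ K t = e^{t·F} e^{−β S_W} dU` (genuinely `t`-dependent), (M1)₀ discharged per slot for `|t| ≤ l₀`; DISPLAYED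
  binders left: the other run's measurable tested variables, the per-cube a.e. closeness, the numerics, `0 ≤ l₀`,
  `|F| ≤ w`, `D_s·e^{2 l₀ w} ≤ D 0`.

WHAT THIS DOES NOT DO.  One lattice (the `K`-indexed lattice family is pointwise the same); the slot COUNT in
`ω K = #(C K)·D₀ρ₀` is (W1)/row S9's; no live level, no rate, no second run from its own measure; NE7c NOT proved;
0/9 spine.
-/

noncomputable section

open Set Function MeasureTheory Finset

namespace Summit.QuantumFields.BalabanUV.T4Continuum.ShellMeasureWilsonLedgerSource

open scoped ENNReal
open Literature.MathematicalPhysics.QuantumFieldTheory.Balaban1983to89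
open T4ShellMeasure (SlotAntiConcentration)
open T4ShellMeasureLevels (LevelLedger)
open T4CubeChartGnomonic (SU2)
open T4AxialGaugeFixing (combBonds)
open T4AxialGaugeSmallField (boxPlaqs boxBonds)
open ShellMeasureWilsonRealizedSU2 (wilsonU measurable_wilsonU measurable_wilsonSum wilsonSum_nonneg)
open ShellMeasureRootCompositionPushCubes (regionWeight regionShell regionPiece levelLedger_levelZero_cubes)
open ShellMeasureWilsonLedger (slotAntiConcentration_wilson_su2_gibbs_of_union)

/-! ## §1 (M1) through a two-sided bounded density factor -/

section Factor

variable {Ω : Type*} [MeasurableSpace Ω]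

/-- (M1) is invariant under scaling the measure by a constant `c ∈ [0, ∞]`. [folklore] -/
theorem slotAntiConcentration_smul {μ : Measure Ω} {u : Ω → ℝ} {θ ρ D : ℝ} (h : SlotAntiConcentration μ u θ ρ D)
    (c : ℝ≥0∞) : SlotAntiConcentration (c • μ) u θ ρ D := by
  unfold SlotAntiConcentration at h ⊢
  rw [Measure.smul_apply, Measure.smul_apply, smul_eq_mul, smul_eq_mul, mul_left_comm]
  exact mul_le_mul_right h c

/-- **(M1) THROUGH A TWO-SIDED BOUNDED FACTOR.**  If `F dν` satisfies (M1) with constant `D` (`D, ρ ≥ 0`) and `g` is a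
factor with `e(a) ≤ g ≤ e(b)` (`e = ENNReal.ofReal`, reals `0 < a ≤ b`), then `(g·F) dν` satisfies (M1) with constant
`D · (b/a)`: the shell mass grows at most by `b`, the total mass shrinks at most by `a`
(`T4ShellMeasureFibre.slotAntiConcentration_of_dominated` with the dominating measure `b • (F dν)`). [folklore] -/
theorem slotAntiConcentration_withDensity_mul_of_bounds (ν : Measure Ω) [SFinite ν] {F g : Ω → ℝ≥0∞}
    (hF : Measurable F) {a b : ℝ} (ha : 0 < a) (hab : a ≤ b) (hga : ∀ x, ENNReal.ofReal a ≤ g x)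
    (hgb : ∀ x, g x ≤ ENNReal.ofReal b) {u : Ω → ℝ} {θ ρ D : ℝ} (hD : 0 ≤ D) (hρ : 0 ≤ ρ)
    (h : SlotAntiConcentration (ν.withDensity F) u θ ρ D) :
    SlotAntiConcentration (ν.withDensity fun x => g x * F x) u θ ρ (D * (b / a)) := by
  have hb : 0 ≤ b := ha.le.trans hab
  -- shell: the tilted mass is at most `b ×` the untilted one
  have hS : (ν.withDensity fun x => g x * F x) {x | θ * (1 - ρ) ≤ u x ∧ u x < θ} ≤
      ((ENNReal.ofReal b) • ν.withDensity F) {x | θ * (1 - ρ) ≤ u x ∧ u x < θ} := by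
    rw [Measure.smul_apply, smul_eq_mul, withDensity_apply' _ _, withDensity_apply' _ _,
      ← lintegral_const_mul _ hF]
    exact lintegral_mono fun x => mul_le_mul_left (hgb x) _
  -- total: the tilted mass is at least `a ×` the untilted one
  have hU : ENNReal.ofReal a * (ν.withDensity F) univ ≤ (ν.withDensity fun x => g x * F x) univ := by
    rw [withDensity_apply' _ _, withDensity_apply' _ _, ← lintegral_const_mul _ hF]
    exact lintegral_mono fun x => mul_le_mul_left (hga x) _
  have hmass : ((ENNReal.ofReal b) • ν.withDensity F) univ ≤
      ENNReal.ofReal (b / a) * (ν.withDensity fun x => g x * F x) univ := by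
    rw [Measure.smul_apply, smul_eq_mul]
    calc ENNReal.ofReal b * (ν.withDensity F) univ
        = ENNReal.ofReal (b / a) * (ENNReal.ofReal a * (ν.withDensity F) univ) := by
          rw [← mul_assoc, ← ENNReal.ofReal_mul (div_nonneg hb ha.le), div_mul_cancel₀ b ha.ne']
      _ ≤ ENNReal.ofReal (b / a) * (ν.withDensity fun x => g x * F x) univ := mul_le_mul_right hU _
  exact T4ShellMeasureFibre.slotAntiConcentration_of_dominated hD hρ hS (slotAntiConcentration_smul h _) hmass

/-- **… THE EXPONENTIAL TILT**: the factor `e^{t·f(x)}` with `|f| ≤ w` and `|t| ≤ l₀` lies in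
`[e^{−l₀w}, e^{l₀w}]`, so (M1) passes from `F dν` to `(e^{t f}·F) dν` at the price `D ↦ D·e^{2 l₀ w}`. [folklore] -/
theorem slotAntiConcentration_withDensity_mul_exp (ν : Measure Ω) [SFinite ν] {F : Ω → ℝ≥0∞} (hF : Measurable F)
    {f : Ω → ℝ} {w l₀ t : ℝ} (hw : 0 ≤ w) (hfw : ∀ x, |f x| ≤ w) (ht : |t| ≤ l₀) {u : Ω → ℝ} {θ ρ D : ℝ}
    (hD : 0 ≤ D) (hρ : 0 ≤ ρ) (h : SlotAntiConcentration (ν.withDensity F) u θ ρ D) :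
    SlotAntiConcentration (ν.withDensity fun x => ENNReal.ofReal (Real.exp (t * f x)) * F x) u θ ρ
      (D * Real.exp (2 * l₀ * w)) := by
  have hl₀ : 0 ≤ l₀ := (abs_nonneg t).trans ht
  have htf : ∀ x, -(l₀ * w) ≤ t * f x ∧ t * f x ≤ l₀ * w := fun x => by
    have h1 : |t * f x| ≤ l₀ * w := by
      rw [abs_mul]; exact mul_le_mul ht (hfw x) (abs_nonneg _) hl₀
    exact abs_le.1 h1
  have hba : Real.exp (l₀ * w) / Real.exp (-(l₀ * w)) = Real.exp (2 * l₀ * w) := by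
    rw [← Real.exp_sub]; ring_nf
  rw [← hba]
  exact slotAntiConcentration_withDensity_mul_of_bounds ν hF (Real.exp_pos _)
    (Real.exp_le_exp.2 (by nlinarith [mul_nonneg hl₀ hw])) (fun x => ENNReal.ofReal_le_ofReal (Real.exp_le_exp.2 (htf x).1))
    (fun x => ENNReal.ofReal_le_ofReal (Real.exp_le_exp.2 (htf x).2)) hD hρ h
end Factor

/-! ## §2 (M1)₀ for the tilted Gibbs law `e^{t·F} e^{−β S_W} dU` -/

section Gibbs

variable {P : Params} {j : ℕ} [DecidableEq (PBond P j)] [DecidableEq (Plaq P j)]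

/-- **(M1)₀ FOR THE SOURCE-TILTED LEVEL-0 GIBBS LAW.**  File 1's `slotAntiConcentration_wilson_su2_gibbs_of_union`
(row S1's geometry/numerics, classifier covering its box, `θ ≤ σ`, `P_ext` avoiding the chart block, `P_ext ∪ P_w =
P_all`) tilted by a bounded observable `Fobs` (`|Fobs| ≤ w`; its measurability is not even needed for the inequality) at source
strength `|t| ≤ l₀`:
`SlotAntiConcentration ((fieldMeasure P j SU2).withDensity (e^{t·Fobs U} · e^{−β Σ_{P_all}(1 − reTr U(∂p))}))
(wilsonU P_u) θ ρ (2(n + β·#P_w·8S(8+32S))/(1−δ) · e^{2 l₀ w})`. [folklore] -/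
theorem slotAntiConcentration_wilson_su2_gibbs_source
    {lo hi : Fin P.d → ℤ} {m : ℕ} (hN : ∀ κ, hi κ - lo κ < P.sitesPerDir j) (hm : ∀ κ, hi κ ≤ lo κ + m)
    (Λ : Finset (PBond P j)) (hΛbox : ∀ b ∈ Λ, b ∈ boxBonds lo hi)
    (hΛcomb : Disjoint Λ (combBonds lo hi))
    (hcov : ∀ b ∈ boxBonds lo hi, b ∉ Λ → b ∈ (combBonds lo hi : Finset (PBond P j)))
    {n : ℕ} (e : ↥Λ × Fin 3 ≃ Fin n)
    {S σ : ℝ} (hS : 0 < S) (hS8 : S ≤ 1 / 8) (hSπ : 3 * S ^ 2 < Real.pi ^ 2) (hσ : 0 < σ)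
    (hrad : ((P.d - 1 : ℕ) : ℝ) * m * σ ≤ 2 * S / Real.pi)
    {Pu : Finset (Plaq P j)} (hPu : Pu.Nonempty) (hPubox : ∀ p ∈ Pu, p ∈ boxPlaqs lo hi)
    (hboxPu : boxPlaqs lo hi ⊆ (↑Pu : Set (Plaq P j)))
    (Pw Pext Pall : Finset (Plaq P j)) {β θ δ ρ : ℝ} (hβ : 0 ≤ β) (hθ : 0 < θ) (hθσ : θ ≤ σ) (hδ0 : 0 ≤ δ)
    (hδ1 : δ < 1) (hρ0 : 0 ≤ ρ) (hρ : ρ ≤ (1 - δ) / 2) (hSM : 4 * (8 * S) ^ 2 * Real.exp (2 * (8 * S)) ≤ δ * θ)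
    (hSMσ : 4 * (8 * S) ^ 2 * Real.exp (2 * (8 * S)) ≤ δ * σ)
    (hPext : ∀ p ∈ Pext, (⟨p.src, p.μ⟩ : PBond P j) ∉ Λ ∧ (⟨p.src.shift p.μ, p.ν⟩ : PBond P j) ∉ Λ ∧
      (⟨p.src.shift p.ν, p.μ⟩ : PBond P j) ∉ Λ ∧ (⟨p.src, p.ν⟩ : PBond P j) ∉ Λ)
    (hdisj : Disjoint Pext Pw) (hall : Pext ∪ Pw = Pall)
    {Fobs : GaugeField P j SU2 → ℝ} {w l₀ t : ℝ} (hw : 0 ≤ w) (hFw : ∀ U, |Fobs U| ≤ w) (ht : |t| ≤ l₀) :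
    SlotAntiConcentration
      ((fieldMeasure P j SU2).withDensity fun U => ENNReal.ofReal (Real.exp (t * Fobs U)) *
        ENNReal.ofReal (Real.exp (-(β * ∑ p ∈ Pall, (1 - reTr (GaugeField.plaqHol U p))))))
      (wilsonU hPu) θ ρ (2 * ((n : ℝ) + β * ∑ _p ∈ Pw, (8 * S) * (8 + 4 * (8 * S))) / (1 - δ) *
        Real.exp (2 * l₀ * w)) := by
  have h1δ : 0 < 1 - δ := by linarith
  refine slotAntiConcentration_withDensity_mul_exp (fieldMeasure P j SU2) ?_ hw hFw ht ?_ hρ0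
    (slotAntiConcentration_wilson_su2_gibbs_of_union hN hm Λ hΛbox hΛcomb hcov e hS hS8 hSπ hσ hrad hPu hPubox hboxPu
      Pw Pext Pall hβ hθ hθσ hδ0 hδ1 hρ0 hρ hSM hSMσ hPext hdisj hall)
  · exact ENNReal.measurable_ofReal.comp
      (Real.measurable_exp.comp (measurable_const.mul (measurable_wilsonSum Pall)).neg)
  · exact div_nonneg (mul_nonneg zero_le_two (add_nonneg (Nat.cast_nonneg _)
      (mul_nonneg hβ (Finset.sum_nonneg fun _ _ => by positivity)))) h1δ.le

end Gibbs

/-! ## §3 The level-0 ledger of the tilted Gibbs measures `μ K t = e^{t·F} e^{−β S_W} dU` -/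

section Ledger

variable {P : Params} {j : ℕ} [DecidableEq (PBond P j)] [DecidableEq (Plaq P j)] {σ₀ : Type*} [DecidableEq σ₀]

/-- **THE LEVEL-0 ONE-RUN LEDGER OF THE SOURCE-TILTED `SU(2)` GIBBS MEASURES ⇐ CLOSENESS + NUMERICS ONLY.**  File 1's
`levelLedger_wilson_su2_levelZero` with the realized measure of every slot at source strength `t` THE TILTED law
`μ t = e^{t·Fobs} e^{−β Σ_{P_all}} dU` (a bounded measurable observable, `|Fobs| ≤ w`; the generating-function
measures of `T4WeightBudget`), (M1)₀ discharged per slot for `|t| ≤ l₀` by §2 and raised to the uniform `D 0`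
(`D_s · e^{2 l₀ w} ≤ D 0`).  DISPLAYED: the other run's measurable tested variables `u^B`, the per-cube a.e. closeness
`|wilsonU_s − u^B_s| ≤ ρ₀θ₀` under `μ t`, the numerics.  NOT NE7c; nothing printed asserted. [folklore] -/
theorem levelLedger_wilson_su2_levelZero_source
    (lo hi : σ₀ → Fin P.d → ℤ) (m : σ₀ → ℕ) (hN : ∀ s κ, hi s κ - lo s κ < P.sitesPerDir j)
    (hm : ∀ s κ, hi s κ ≤ lo s κ + m s)
    (Λ : σ₀ → Finset (PBond P j)) (hΛbox : ∀ s, ∀ b ∈ Λ s, b ∈ boxBonds (lo s) (hi s))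
    (hΛcomb : ∀ s, Disjoint (Λ s) (combBonds (lo s) (hi s)))
    (hcov : ∀ s, ∀ b ∈ boxBonds (lo s) (hi s), b ∉ Λ s → b ∈ (combBonds (lo s) (hi s) : Finset (PBond P j)))
    (n : σ₀ → ℕ) (e : ∀ s, ↥(Λ s) × Fin 3 ≃ Fin (n s))
    {S σ : ℝ} (hS : 0 < S) (hS8 : S ≤ 1 / 8) (hSπ : 3 * S ^ 2 < Real.pi ^ 2) (hσ : 0 < σ)
    (hrad : ∀ s, ((P.d - 1 : ℕ) : ℝ) * m s * σ ≤ 2 * S / Real.pi)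
    (Pu : σ₀ → Finset (Plaq P j)) (hPu : ∀ s, (Pu s).Nonempty) (hPubox : ∀ s, ∀ p ∈ Pu s, p ∈ boxPlaqs (lo s) (hi s))
    (hboxPu : ∀ s, boxPlaqs (lo s) (hi s) ⊆ (↑(Pu s) : Set (Plaq P j)))
    (Pw Pext : σ₀ → Finset (Plaq P j)) (Pall : Finset (Plaq P j)) {β δ : ℝ} {θ ρ D : ℕ → ℝ} (hβ : 0 ≤ β)
    (hθ : 0 < θ 0) (hθσ : θ 0 ≤ σ) (hδ0 : 0 ≤ δ) (hδ1 : δ < 1) (hρ0 : ∀ i, 0 ≤ ρ i) (hρ : ρ 0 ≤ (1 - δ) / 2)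
    (hSM : 4 * (8 * S) ^ 2 * Real.exp (2 * (8 * S)) ≤ δ * θ 0)
    (hSMσ : 4 * (8 * S) ^ 2 * Real.exp (2 * (8 * S)) ≤ δ * σ)
    (hPext : ∀ s, ∀ p ∈ Pext s, (⟨p.src, p.μ⟩ : PBond P j) ∉ Λ s ∧ (⟨p.src.shift p.μ, p.ν⟩ : PBond P j) ∉ Λ s ∧
      (⟨p.src.shift p.ν, p.μ⟩ : PBond P j) ∉ Λ s ∧ (⟨p.src, p.ν⟩ : PBond P j) ∉ Λ s)
    (hdisj : ∀ s, Disjoint (Pext s) (Pw s)) (hall : ∀ s, Pext s ∪ Pw s = Pall)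
    -- the source: a bounded measurable observable tilting the Gibbs law, strength `|t| ≤ l₀`
    {Fobs : GaugeField P j SU2 → ℝ} {w l₀ : ℝ} (hw : 0 ≤ w) (hFw : ∀ U, |Fobs U| ≤ w)
    (hD0 : ∀ i, 0 ≤ D i)
    (hD : ∀ s, 2 * ((n s : ℝ) + β * ∑ _p ∈ Pw s, (8 * S) * (8 + 4 * (8 * S))) / (1 - δ) * Real.exp (2 * l₀ * w) ≤ D 0)
    -- the run's cubes per cutoff, the other run's tested variables, the closeness (node U1b at level 0)
    (C : ℕ → Finset σ₀) (uB : ℕ → ℝ → σ₀ → GaugeField P j SU2 → ℝ) (huB : ∀ K t s, Measurable (uB K t s))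
    (hclose : ∀ K t, |t| ≤ l₀ → ∀ s ∈ C K,
      ∀ᵐ U ∂((fieldMeasure P j SU2).withDensity fun U => ENNReal.ofReal (Real.exp (t * Fobs U)) *
        ENNReal.ofReal (Real.exp (-(β * ∑ p ∈ Pall, (1 - reTr (GaugeField.plaqHol U p)))))),
        |wilsonU (hPu s) U - uB K t s U| ≤ ρ 0 * θ 0) :
    LevelLedger l₀ (fun K => (C K).powerset)
      (fun K t => regionWeight (C K)
        ((fieldMeasure P j SU2).withDensity fun U => ENNReal.ofReal (Real.exp (t * Fobs U)) *
          ENNReal.ofReal (Real.exp (-(β * ∑ p ∈ Pall, (1 - reTr (GaugeField.plaqHol U p))))))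
        (fun s => wilsonU (hPu s)) (θ 0))
      (fun K t => regionShell (C K)
        ((fieldMeasure P j SU2).withDensity fun U => ENNReal.ofReal (Real.exp (t * Fobs U)) *
          ENNReal.ofReal (Real.exp (-(β * ∑ p ∈ Pall, (1 - reTr (GaugeField.plaqHol U p))))))
        (fun s => wilsonU (hPu s)) (uB K t) (θ 0))
      C
      (fun K t => regionPiece (C K)
        ((fieldMeasure P j SU2).withDensity fun U => ENNReal.ofReal (Real.exp (t * Fobs U)) *
          ENNReal.ofReal (Real.exp (-(β * ∑ p ∈ Pall, (1 - reTr (GaugeField.plaqHol U p))))))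
        (fun s => wilsonU (hPu s)) (uB K t) (θ 0))
      (fun _ _ => 0) D ρ := by
  -- every tilted Gibbs law is a finite measure (density ≤ e^{|t| w} against the product Haar probability)
  haveI : ∀ t : ℝ, IsFiniteMeasure ((fieldMeasure P j SU2).withDensity fun U =>
      ENNReal.ofReal (Real.exp (t * Fobs U)) *
        ENNReal.ofReal (Real.exp (-(β * ∑ p ∈ Pall, (1 - reTr (GaugeField.plaqHol U p)))))) := fun t => by
    refine isFiniteMeasure_withDensity (ne_top_of_le_ne_top ?_ (lintegral_mono (g := fun _ =>
      ENNReal.ofReal (Real.exp (|t| * w))) fun U => ?_))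
    · rw [lintegral_const]; exact ENNReal.mul_ne_top ENNReal.ofReal_ne_top (measure_ne_top _ _)
    · calc ENNReal.ofReal (Real.exp (t * Fobs U)) *
            ENNReal.ofReal (Real.exp (-(β * ∑ p ∈ Pall, (1 - reTr (GaugeField.plaqHol U p)))))
          ≤ ENNReal.ofReal (Real.exp (|t| * w)) * 1 := by
            refine mul_le_mul' (ENNReal.ofReal_le_ofReal (Real.exp_le_exp.2 ?_)) ?_
            · calc t * Fobs U ≤ |t * Fobs U| := le_abs_self _
                _ = |t| * |Fobs U| := abs_mul _ _
                _ ≤ |t| * w := mul_le_mul_of_nonneg_left (hFw U) (abs_nonneg t)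
            · rw [ENNReal.ofReal_le_one, Real.exp_le_one_iff, neg_nonpos]
              exact mul_nonneg hβ (wilsonSum_nonneg Pall U)
        _ = ENNReal.ofReal (Real.exp (|t| * w)) := mul_one _
  -- (M1)₀ per slot for `|t| ≤ l₀`, raised to the uniform constant `D 0`
  have hac : ∀ (K : ℕ) (t : ℝ), |t| ≤ l₀ → ∀ s ∈ C K, SlotAntiConcentration
      ((fieldMeasure P j SU2).withDensity fun U => ENNReal.ofReal (Real.exp (t * Fobs U)) *
        ENNReal.ofReal (Real.exp (-(β * ∑ p ∈ Pall, (1 - reTr (GaugeField.plaqHol U p))))))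
      (wilsonU (hPu s)) (θ 0) (ρ 0) (D 0) := fun K t ht s _ =>
    T4ShellMeasureFibre.slotAntiConcentration_mono (hρ0 0) (hD s)
      (slotAntiConcentration_wilson_su2_gibbs_source (hN s) (hm s) (Λ s) (hΛbox s) (hΛcomb s) (hcov s) (e s) hS hS8
        hSπ hσ (hrad s) (hPu s) (hPubox s) (hboxPu s) (Pw s) (Pext s) Pall hβ hθ hθσ hδ0 hδ1 (hρ0 0) hρ hSM hSMσ
        (hPext s) (hdisj s) (hall s) hw hFw ht)
  exact levelLedger_levelZero_cubes
    (μ := fun _ t => (fieldMeasure P j SU2).withDensity fun U => ENNReal.ofReal (Real.exp (t * Fobs U)) *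
      ENNReal.ofReal (Real.exp (-(β * ∑ p ∈ Pall, (1 - reTr (GaugeField.plaqHol U p))))))
    (uA := fun _ _ s => wilsonU (hPu s)) (fun _ _ s => measurable_wilsonU (hPu s)) huB hclose hD0 hρ0 hac

end Ledger

end Summit.QuantumFields.BalabanUV.T4Continuum.ShellMeasureWilsonLedgerSource

end
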